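import Summits.BirchSwinnertonDyer.BirchSwinnertonDyer.Theorems.ErratumRoadFiveBdvCalibrationSplitNFDefs
import HarnessLib

/-!
# The BDV-calibration split of `A♭-fam` — NEWFORM-SHAPED calibrator `S2-NF` ON R: CalibratorDefs (the binder `NFCalibratorDatum`,
# the statements S1-NF-on-R ∕ S2-NF, the finer split, the `∃ P`-bundled registrable texts)
# (crux stmt-BirchSwinnertonDyer-19715, (α2) item stmt-BirchSwinnertonDyer-33169; deliverable (622)(1) of idea-9, PORTED — d2R P2)

Second of the three modules of the BUILT port (LEAD `bsd-line-er5-p1` g20) of the crux WORKFILE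
`Cruxes/EulerHalfNotRamNoInertSetAtFive/Lines/bdv_calibration_split_nf_Sketch.lean` rev 1.2.1 (commit 1a3edf267b08, 950 l., sha16 402b542340c4b640; critic idea-crit-14 V381 PASS on rev 1.2, rev 1.2.1 = docstring-only touch-up paying V381 N1–N4; FROZEN for d2R);
see `ErratumRoadFiveBdvCalibrationSplitNFDefs` for provenance, the ONE-CONSTANT RULE, currency (§A), the D-twins (§B), the twin
table (§C).  Texts 1:1 with the workfile: §2 `NFCalibratorDatum` (rev 1.2: + `congrIdx`, `congrIdx_spec`, `congrIdx_ne` — the NF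
chain's OWN INDEX `c̃_g`, NAMED) + `rhs` (pinning `(a,b) = (0,0)`) + `rhsCanonical` (+ two lemmas); §3 `BdvChainNFConjunct`, S1-NF-on-R
`BdvChainExplicitNFR` (= `∃ V, BdvChainCurveConjunctR V ∧ BdvChainNFConjunct P V`), S2-NF `EisensteinPeriodRatioValuationNF`; §4
S2a-NF `CalibratorSupplyNF`, S2b-NF `CalibratorDataRealisableNF`, S2c-NF `BstwIntegralPerrinRiouNF`; §5 `BdvCalibrationNFR`,
`BdvCalibrationPiecesNFR`, the P-NF1 polarity witness `junkPort` ∕ `junkPort_hasBKLog_trivial`.  `@[conjecture]` on the seven OPEN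
statements (cell RULING 75; the two closed `[cite]`d `Prop`s of §5 are thereby obligation nodes, not Literature facts).  The PROVED
recompositions to the IMPORTED `ErratumRoadFiveBdvCalibrationSplitR.AFlatFamStatementR` live in `ErratumRoadFiveBdvCalibrationSplitNF`.

NOTHING here proves a summit statement; every `@[conjecture]` constant is OPEN and asserted nowhere; typed ≠ proved; BSD is
proved for no curve.  Workfile docstring §D–§G follow verbatim.

## D. Q3 — must S1's `V` be uniform over curve targets AND newform calibrators?  YES.

The glue consumes S1 AT THE CALIBRATOR (to pin `V p d_L = 0`) and AT THE TARGET (to conclude); the printed supply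
(BSTW Prop. 4.23 p.45 L48–64, §8.2 p.66 L43–66, Lemma 8.2) yields CM newforms `g_ψ`, so `BdvChainExplicitNF` quantifies ONE
`V : ℕ → ℤ → ℤ` over {rational non-exceptional rank-one curves} ∪ {`NFCalibratorDatum`s}.  This is BDV's own move:
[BDV22 §4.6 p.44 L13–15] the constant of (38) «depends on `(K,p)` but not on `f`», and the proof of Lemma 4.6
[p.44 L33–67, p.45 L1–46] APPLIES (38) to the CM theta series `f_{χ_D}` of level `D²` with the same constant; BSTW's
`u_L` is pinned the same way [p.60 L86–96: «`u_L ∈ ⋂_{ψ∈𝔛} F_ψ = ℚ`»].  The uniformity is definitional once both members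
are read in the SAME canonical (optimal) normalisation — for curves this is Rem. 1.3 [BSTW p.14 L133].
Kill criterion of (622) for (b′) («a D1–D5 port that needs a curve-side hypothesis not in BSTW»): NOT TRIGGERED on the
print side — every clause of `NFCalibratorDatum` is newform-level in BSTW Thm. 6.4/§6.2.1 and Kato 2004; the one
non-printed input is the realisation of D3 (`NFPort`), which is curve-free by construction.

## E. Degeneracy caveat (honest)

Over an ARBITRARY `P : NFPort` the statements are schematic: `EisensteinPeriodRatioValuationNF P L p` has content
exactly when `P.HasBKLog` is the intended Bloch–Kato logarithm; for junk `P` (e.g. `HasBKLog := ⊤`) S2-NF degenerates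
and S1-NF's newform conjunct becomes false or vacuous accordingly.  The recomposition theorem is proved UNIFORMLY in
`P`, so nothing false is asserted; the typer's port replaces `P` by the constructed instance.  4c-checklist: (ii) no
Bochner integrals; (iv) no hand-picked thresholds (the shift is `∃ V`); quantifier order as on the curve side.

## F. Critic idea-crit-14 V359 N1 / A214 O1–O3 (2026-08-30T17:24–17:26Z) — answered in the typing

N1 («S1's class must CONTAIN the calibrators»): `BdvChainExplicitNF P := ∃ V, BdvChainCurveConjunct V ∧ BdvChainNFConjunct P V`
— ONE `V` bound once outside both conjuncts; the glue uses the NF conjunct at the calibrator and the curve conjunct at the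
target (§D).  O1 (`p` split in `L` throughout BSTW §4–§6): carried by the OUTER binder `SatisfiesHeegnerHypothesis p L` of
both S1-NF and S2-NF (as registered), not restated inside the datum.  O2 (Lemma 8.2 needs `L ∉ {ℚ(i), ℚ(√−2)}`): implied by
the registered outer binders `NumberField.discr L < −4 ∧ Odd (NumberField.discr L)` (`d_L ∉ {−4, −8}`), so `u_L ∈ ℤ_(p)^×`
[BSTW p.60 L86–96] is available for every caller's `L`.  O3 (the four `F^×`-constants of (log-Kato-elt-1)): `L(1,g′)/Ω⁻` is
CARRIED EXPLICITLY as `‖s′‖_λ` in `NFCalibratorDatum.rhs` (`√|d_L|·L(g⊗χ_L,1) = s′·Ω⁻`, field `hs'`) — it is the newform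
twin of the descent scalar `s` and is NOT hidden in the calibrated constant; `c(ω,γ,γ′) ∈ O_λ^×` at `p ∤ N` [Prop. 4.13 (ii)]
and `‖𝔤(χ_L)‖_λ = 1` (`p ∤ d_L`) are units; `c_g` (`φ_A^* ω_A = c_g ω_g`) does NOT occur because the identity is read on
`J₀(N)`/the newform [first form of (log-Kato-elt-1), p.60 L17–24], never on a quotient `A` — and the curve side's `k`
(`c·Ω⁻_f = k·Ω⁻_E`) and Manin `c` have no twin because `Ω⁻` IS the optimal period (§A).  The Kato-side normalisation
constant `q′` and cusp/Euler data `R′`, `E′_ℓ` are carried explicitly in `rhs` exactly as `q`, `R`, `P_ℓ` are on the curve side.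

## G. rev 1.1 — critic V361 (2026-08-30T18:06Z, PASS-WITH-PRICE): P-NF1 paid, C1/C2 carried

P-NF1 (POLARITY OF THE PORT).  `P : NFPort` as a free parameter is sound for the GLUE (`AFlatFamStatement` does not mention
`P`) but NOT for registered items: with the junk port `P₀ := ⟨fun … ↦ True⟩` the field `σ` is free in every datum, so
`∀ P, BdvChainExplicitNF P` is refutable modulo supply and `EisensteinPeriodRatioValuationNF P₀ L p` is vacuous-true modulo
supply.  The REGISTRABLE texts are therefore the `∃ P`-BUNDLED ones of §5 below — `BdvCalibrationNF := ∃ P, S1-NF P ∧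
(∀ p ≥ 5 ∀ adm L, S2-NF P L p)` (ONE `P` shared by S1-NF and S2-NF, the same polarity lesson as the single `V`) and its
three-piece variant `BdvCalibrationPiecesNF` — each with a proved glue to `AFlatFamStatement`; or `P` pinned to a named
constructed predicate once the tree has `D_dR`/`exp_BK`.  Never `variable (P : NFPort)` + per-statement stubs.
C1 (WHERE THE CONTENT SITS).  Given S2c-NF and supply at every admissible `(p, d_L)`, S1-NF forces `V ≡ 0` there, so the
line's research content is the VALUATION-currency `f`-blindness of BDV's explicit scalar — see the sharpened «Why it might
fail» of `BdvChainExplicitNF` and the falsifier T0 in the memo.  C2: see the docstring of `CalibratorSupplyNF`.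
-/

set_option autoImplicit false
-- D-0017: single-problem summit, so `Summit.BirchSwinnertonDyer.BirchSwinnertonDyer.…` repeats a namespace BY DESIGN.
set_option linter.dupNamespace false

noncomputable section

open scoped Classical NumberField TensorProduct BigOperators Pointwise

namespace Summit.BirchSwinnertonDyer.BirchSwinnertonDyer.Theorems.ErratumRoadFiveBdvCalibrationSplitNF

open Field
open Literature.NumberTheory.GaloisRepresentations
open Literature.NumberTheory.EllipticCurves Literature.NumberTheory.EllipticCurves.Kato2004
open Literature.NumberTheory.EllipticCurves.Kato2004.EulerSystemValues
open Literature.NumberTheory.EllipticCurves.Rank1Residual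
open Literature.NumberTheory.EllipticCurves.Rank1Residual.Typed
open Literature.NumberTheory.EllipticCurves.ModularForms
open Literature.NumberTheory.EllipticCurves.Castella2018
open Summit.BirchSwinnertonDyer.Rank1Residual
open Summit.BirchSwinnertonDyer.BirchSwinnertonDyer.Theorems.ErratumRoadFiveBdvCalibrationSplit
open Summit.BirchSwinnertonDyer.BirchSwinnertonDyer.Theorems.ErratumRoadFiveBdvCalibrationSplitR
open IsDedekindDomain (HeightOneSpectrum)
open CongruenceSubgroup (Gamma0)
open Rat.HeightOneSpectrum (primesEquiv)

/-! ## §2 The S2-NF binder: `NFCalibratorDatum P p L` (calibrator class + value-pinned newform frame) -/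

set_option genInjectivity false in
set_option maxHeartbeats 4000000 in
set_option synthInstance.maxHeartbeats 200000 in
/-- **The S2-NF binder list as ONE structure** (the newform twin of the registered frame's binders from `∀ Dt …` on):
a newform `g ∈ S₂(Γ₀(N))` in the CALIBRATOR CLASS at `(L, p)` — `p ∤ 2N`, `λ`-ordinary, `ρ̄` absolutely irreducible,
Heegner for `L` at `N`, `ord_{s=1} L(g,s) = 1`, `L(g ⊗ χ_L, 1) ≠ 0` [BSTW24 §6.2.1 p.59 L101–p.60 L24; Prop. 4.23 p.45] —
with its `ℚ̄_p`-representation (D1, cited), optimal periods (D2p), a value-pinned Kato family (D2) with guards, the scalar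
`s′` (`√|d_L| · L(g ⊗ χ_L,1) = s′ Ω⁻`), a BDP frame and its value `X′` at the trivial character (form-typed tree predicates),
and a Bloch–Kato logarithm `σ′ ≠ 0` of the bottom class (D3 via `P`).
[cite: BurungaleSkinnerTianWan2024, Thm. 6.4 and §6.2.1 (86)–(94), p. 59–60] [cite: Kato2004Asterisque, Thm. 12.5, p. 229] -/
structure NFCalibratorDatum (P : NFPort) (p : ℕ) [Fact p.Prime] (L : Type) [Field L] [NumberField L] where
  /-- level -/
  N : ℕ
  [neZero : NeZero N]
  /-- the newform -/
  g : CuspForm (Gamma0 N) 2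
  newform : IsNewform0 g
  good : ¬ p ∣ 2 * N
  /-- the frame's `ℚ̄_p ≃ ℂ` (fixes `λ ∣ p` and `𝔭 ∣ p`) -/
  ι' : PadicAlgCl p ≃+* ℂ
  /-- D1 (cited) -/
  ρ : FramedGaloisRep ℚ (PadicAlgCl p) 2
  galois : IsGaloisRepOfNewform1 (liftToGamma1 N 2 g)
    (ι'.symm.toRingHom.comp (algebraMap (coeffCharField (liftToGamma1 N 2 g)) ℂ)) {ℓ : ℕ | ℓ ∣ N * p} ρ
  irr : ρ.IsResiduallyAbsIrreducible
  ordinary : ‖ι'.symm (cuspCoeff g p)‖ = 1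
  heegner : SatisfiesHeegnerHypothesis N L
  rankOne : ∃ Λ ∈ completedCuspFormLContinuations N g, analyticOrderNatAt Λ 1 = 1
  /-- `χ_L` (Kronecker character of `L`, pinned on odd `n` by the Jacobi symbol — tree idiom) and `L(g ⊗ χ_L, s)` -/
  χL : DirichletCharacter ℂ (NumberField.discr L).natAbs
  χL_spec : ∀ n : ℕ, Odd n → χL n = (jacobiSym (NumberField.discr L) n : ℂ)
  LχL : ℂ → ℂ
  LχL_diff : Differentiable ℂ LχL
  LχL_spec : ∀ s : ℂ, 2 < s.re → LχL s = twistedLSeries g χL s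
  twist_ne_zero : LχL 1 ≠ 0
  /-- D2p -/
  Ωp : ℂ
  Ωm : ℂ
  optimal : IsOptimalPeriodPair p g ι' Ωp Ωm
  /-- rev 1.2 §H (H2): the NF chain's OWN INDEX — BSTW's `Γ₁(N)`-congruence number `c̃_g` (a generator over `O_λ`), NAMED;
  the value functional `Λ` below reads `exp*` in the coordinate of the good differential `ω_g/c̃_g` (pinning `a = 0`). -/
  congrIdx : PadicAlgCl p
  congrIdx_spec : P.IsCongruenceGenerator p g ι' congrIdx
  congrIdx_ne : congrIdx ≠ 0
  /-- the Gross–Zagier scalar `s′` -/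
  s' : ℂ
  hs' : (Real.sqrt ((NumberField.discr L).natAbs : ℝ) : ℂ) * LχL 1 = s' * Ωm
  /-- D2: the value-pinned Kato family -/
  ι : (n : ℕ) → (CyclotomicField n ℚ →+* ℂ)
  q : ℂ
  hq : q ≠ 0
  Λ : ∀ (m : ℕ) (r : Finset (HeightOneSpectrum (𝓞 ℚ))),
    H1 ρ.toGaloisRep (cycSubgroup p m r) →ₗ[PadicAlgCl p] PadicAlgCl p ⊗[ℚ] CyclotomicField (cycLevel p m r) ℚ
  c : ℤ
  d₁ : ℤ
  a : ℤ
  A : ℕ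
  d' : ℤ
  z : ∀ (m : ℕ) (r : (cyclotomicLevelsRat p (badPlaces c d₁ A N)).Ideals),
    H1 ρ.toGaloisRep ((cyclotomicLevelsRat p (badPlaces c d₁ A N)).level m r.1)
  x : ∀ (m : ℕ) (r : (cyclotomicLevelsRat p (badPlaces c d₁ A N)).Ideals),
    PadicAlgCl p ⊗[ℚ] CyclotomicField (cycLevel p m r.1) ℚ
  zeta : ZetaBodyNF p ρ g ι' ι q Ωp Ωm Λ c d₁ a A z x
  hA : 0 < A
  hcg : Int.gcd c (6 * p * A) = 1
  hd : Int.gcd d₁ (6 * p * N) = 1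
  hdd' : (d₁ : ℤ) * d' ≡ 1 [ZMOD (A : ℤ)]
  hR : cuspFactorNF g Ωp Ωm true (fun _ ↦ 1) c d₁ a A d' ≠ 0
  /-- BDP frame (form-typed tree predicates) -/
  w₀ : NumberField.InfinitePlace L
  κ : ZpExtension L p
  γ' : absoluteGaloisGroup L
  ΩK : ℂ
  Ωpp : (unrIntegers p)ˣ
  Λg : UnrSeries p
  hκ : κ.IsAnticyclotomic
  hγ' : κ.IsTopGenerator γ'
  hΩK : ΩK ≠ 0
  bdp : IsBDPLFunction ι' (X11b.primeOfEmbeddingDatum p ι' w₀.embedding) κ γ' g ΩK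
    ((Ωpp : unrIntegers p) : ℂ_[p]) Λg
  X : ℂ_[p]
  hX : Λg.HasValueAt 0 X
  /-- D3: the Bloch–Kato logarithm of the bottom class `z_{0,∅} ∈ H¹(ℚ, ρ)` -/
  σ : PadicAlgCl p
  hσ : P.HasBKLog p g ι' ρ (z 0 (cyclotomicLevelsRat p (badPlaces c d₁ A N)).idealOne) σ
  hσ0 : σ ≠ 0

namespace NFCalibratorDatum

variable {P : NFPort} {p : ℕ} [Fact p.Prime] {L : Type} [Field L] [NumberField L]

/-- The right-hand side of the NF crossing identity in NORM FORM (module docstring §A):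
`p · ‖p + 1 − a_p(g)‖_λ · ‖s′‖_λ · ‖σ′‖ / ‖q′ · R′ · ∏_{ℓ ∣ A, ℓ ≠ p} E′_ℓ‖_λ` — the twin of
`p ^ bdvExplicitExponent p a_p c s k r_f m_f (v(σ) + ord_p(perRatio/(q R ∏ P_ℓ)))` with `c = k = Γ₀ = 0`, `perRatio = 1`.
EXACT under the rev 1.2 port pinning `(a, b) = (0, 0)` of §H (H2) (class `q′·𝐳_{γ_g}`, log along `η_{ω_g}`): the NF chain's own
index `c̃_g = D.congrIdx` has multiplicity `m = 0` here; the canonical pinning's right-hand side is `rhsCanonical`.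
[cite: BurungaleSkinnerTianWan2024, §6.2.1 (log-Kato-elt-1), p. 60] [cite: BertoliniDarmonVenerucci2022, §4 (38), p. 44] -/
def rhs (D : NFCalibratorDatum P p L) : ℝ :=
  (p : ℝ) * ‖D.ι'.symm ((p : ℂ) + 1 - cuspCoeff D.g p)‖ * ‖D.ι'.symm D.s'‖ * ‖D.σ‖ /
    ‖D.ι'.symm (D.q * cuspFactorNF D.g D.Ωp D.Ωm true (fun _ ↦ 1) D.c D.d₁ D.a D.A D.d' *
        ∏ ℓ ∈ D.A.primeFactors.erase p, eulerFactorAtOneNF D.g D.N ℓ)‖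

/-- The right-hand side under the `c̃`-free CANONICAL pinning `(a, b) = (1, 0)` of §H (H2) (value functional AND logarithm
both along the fixed `ω_g`; pinned class `q′·𝐳_{δ_g} = q′·c̃_g·𝐳_{γ_g}`, multiplicity `m = +1`): `rhs / ‖c̃_g‖_λ`.
[cite: BurungaleSkinnerTianWan2024, Lemma 1.5 (ii) p. 15 and §6.2.1 (log-Kato-elt-1), p. 60] -/
def rhsCanonical (D : NFCalibratorDatum P p L) : ℝ :=
  D.rhs / ‖D.congrIdx‖

/-- When `λ ∤ c̃_g` (`‖c̃_g‖_λ = 1`; §H (H3)) the two pinnings have the same right-hand side. [folklore] -/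
theorem rhsCanonical_eq_rhs_of_norm_eq_one (D : NFCalibratorDatum P p L) (h : ‖D.congrIdx‖ = 1) :
    D.rhsCanonical = D.rhs := by
  rw [rhsCanonical, h, div_one]

/-- In general the two right-hand sides differ exactly by the NF chain's own index: `rhs = ‖c̃_g‖_λ · rhsCanonical`. [folklore] -/
theorem rhs_eq_norm_congrIdx_mul_rhsCanonical (D : NFCalibratorDatum P p L) :
    D.rhs = ‖D.congrIdx‖ * D.rhsCanonical := by
  rw [rhsCanonical, mul_div_cancel₀ _ (norm_ne_zero_iff.mpr D.congrIdx_ne)]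

end NFCalibratorDatum

/-! ## §3 The statements S1-NF (ON R) and S2-NF (the PROVED recomposition to `AFlatFamStatementR` lives in `ErratumRoadFiveBdvCalibrationSplitNF`) -/

/-- The NEWFORM conjunct of S1 at the shift function `V`: on every calibrator datum at an admissible `(L, p)`, `p ≥ 5`,
the NF crossing identity holds up to the SAME `(p, d_L)`-shift `p^{−V p d_L}` as on the curve side (§D of the module
docstring: BDV's constant is `f`-blind and BDV themselves apply (38) to CM theta series, Lemma 4.6).
[cite: BertoliniDarmonVenerucci2022, §4.6 (38) L13–15 and Lemma 4.6, p. 44–45] -/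
def BdvChainNFConjunct (P : NFPort) (V : ℕ → ℤ → ℤ) : Prop :=
  ∀ (p : ℕ) [Fact p.Prime], 5 ≤ p → ∀ (L : Type) [Field L] [NumberField L],
    IsImaginaryQuadratic L → SatisfiesHeegnerHypothesis p L → NumberField.discr L < -4 → Odd (NumberField.discr L) →
    ∀ D : NFCalibratorDatum P p L, ‖D.X‖ = (p : ℝ) ^ (-(V p (NumberField.discr L))) * D.rhs

/-- **S1-NF — `BdvChainExplicitNFR P`: BDV22 (38) valued up to its `(K,p)`-constant, over curves AND newform calibrators
with ONE shift function `V`** (= deliverable 1's `BdvChainExplicitNonsplit` body ∧ `BdvChainNFConjunct`, same `V`).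
Why it might fail (critic V361 C1 — this is WHERE THE LINE'S CONTENT SITS): BDV state (38) «up to multiplication by a
non-zero explicit scalar in the number field `K(a_n(f_α); n ≥ 1)`» [p.44 L19–21] — `f`-DEPENDENT a priori; «one `V`» asserts
that the `λ`-adic VALUATION of that scalar is the same function of `(p, d_L)` at the `p`-NEW multiplicative non-split member
(`p ∥ N`, `a_p = −1`, frozen `β`; no integral Thm. 3.1 in print) and at GOOD-ordinary CM members `g_ψ` of OTHER Hida families;
the `(1 − 1/α)²`-type factors are units at `α = −1`, `p` odd, but the `Γ`- and period-normalisation part of the scalar across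
families is the unverified piece (cheapest falsifier T0 of the memo: transcribe the scalar for both members and compare
`λ`-valuations).  Kato's reciprocity (ERLIint) and BDP themselves are newform-level and add nothing newform-specific.
[cite: BertoliniDarmonVenerucci2022, §4 (38) p. 44 L19–21 and Lemma 4.6, p. 44–45]
[cite: BurungaleSkinnerTianWan2024, Prop. (ERLIint) and §6.2.1, p. 60] -/
@[conjecture]
def BdvChainExplicitNFR (P : NFPort) : Prop :=
  ∃ V : ℕ → ℤ → ℤ, BdvChainCurveConjunctR V ∧ BdvChainNFConjunct P V

/-- **S2-NF — `EisensteinPeriodRatioValuationNF P L p`: a NEWFORM calibrator exists at `(L, p)`** — some datum of the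
calibrator class carries a non-zero BDP value on which the NF crossing identity holds EXACTLY (norm form, §A).  Supply is
THEOREM-shaped [BSTW24 Prop. 4.23 p.45 L48–64, §8.2 p.66 L43–66, Lemma 8.2; Rohrlich 1984]: CM newforms `g_ψ`; the identity
is BSTW Thm. 6.4's proof, §6.2.1 (86)–(94) with `u_L ∈ ℤ_(p)^×` (p.60 L86–96).  Why it might fail: only through the port —
D3 must be realised by the genuine Bloch–Kato logarithm and (C5)'s normalisation must match BSTW's `O`-basis `γ = γ_g = δ_g/c̃_g` — rev 1.2 §H pinning, rev 1.1 wrote «`δ_g`» (the `q′ R′ ∏E′`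
correction is carried explicitly in `rhs`). [cite: BurungaleSkinnerTianWan2024, Thm. 6.4, §6.2.1 (86)–(94) p. 60, Prop. 4.23 p. 45, Lemma 8.2 p. 66] -/
@[conjecture]
def EisensteinPeriodRatioValuationNF (P : NFPort) (L : Type) [Field L] [NumberField L] (p : ℕ) [Fact p.Prime] : Prop :=
  ∃ D : NFCalibratorDatum P p L, D.X ≠ 0 ∧ ‖D.X‖ = D.rhs

/-! ## §4 The finer split of S2-NF — SUPPLY (theorem-shaped in print) · REALISABILITY (port) · BSTW (print) -/

/-- **S2a-NF — `CalibratorSupplyNF L p`: the calibrator CLASS is non-empty at `(L, p)`** — a newform `g ∈ S₂(Γ₀(N))`,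
`p ∤ 2N`, with `ℚ̄_p`-representation `ρ` attached via `ι′`, `ρ̄` absolutely irreducible, `λ`-ordinary, Heegner for `L` at
`N`, of analytic rank one, with `L(g ⊗ χ_L, 1) ≠ 0`.  THEOREM-shaped: BSTW's auxiliary CM family `𝔛` [Prop. 4.23 p.45
L48–64; §8.2 (i)–(viii) p.66 L43–66; Lemma 8.2 p.66 L67–p.67] with Rohrlich's non-vanishing [Ro84, p. 551] supplies CM
newforms `g_ψ` in the class (the curve-shaped `CalibratorSupply` of deliverable 1 is OPEN in print — this is the point of
(b′)).  Why it might fail: transcription risk only — THEOREM-shaped modulo D1 (existence of `ρ`, a cite) and modulo matching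
𝔛's conditions to these clauses (critic V361 C2): `ε(g_ψ) = −1` is 𝔛 (vi) [p.66 L56]; `λ`-ordinarity from 𝔛 (i) «`p` splits in
`K`» (the CM field) via Cor. 6.6; Heegner for `L` from 𝔛 (vii) «every prime dividing `D_K N(𝔣_ψ)` splits in `L`»; analytic rank
one = 𝔛 (viii); `ρ̄_{g_ψ} = Ind ψ̄` absolutely irreducible and the remaining local conditions are BSTW's §7 hypotheses
(A-psi-res), (A-split), (A-good) of Thm. 7.1 [p.64 L49] — the typer states the exact clause used (our materialisation lacks
pp. 61–63 where they are spelled out); the twist branch `L(g_ψ ⊗ χ_L, 1) ≠ 0` is Prop. 4.23's second Rohrlich application,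
not among (i)–(viii) [R2 memo; critic A214]. [cite: BurungaleSkinnerTianWan2024, Prop. 4.23 p. 45, §8.2 and Lemma 8.2 p. 66–67]
[cite: Rohrlich1984, p. 551] -/
@[conjecture]
def CalibratorSupplyNF (L : Type) [Field L] [NumberField L] (p : ℕ) [Fact p.Prime] : Prop :=
  ∃ (N : ℕ) (_ : NeZero N) (g : CuspForm (Gamma0 N) 2) (ι' : PadicAlgCl p ≃+* ℂ)
    (ρ : FramedGaloisRep ℚ (PadicAlgCl p) 2),
    IsNewform0 g ∧ ¬ p ∣ 2 * N ∧
    IsGaloisRepOfNewform1 (liftToGamma1 N 2 g)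
      (ι'.symm.toRingHom.comp (algebraMap (coeffCharField (liftToGamma1 N 2 g)) ℂ)) {ℓ : ℕ | ℓ ∣ N * p} ρ ∧
    ρ.IsResiduallyAbsIrreducible ∧ ‖ι'.symm (cuspCoeff g p)‖ = 1 ∧
    SatisfiesHeegnerHypothesis N L ∧
    (∃ Λ ∈ completedCuspFormLContinuations N g, analyticOrderNatAt Λ 1 = 1) ∧
    ∃ (χL : DirichletCharacter ℂ (NumberField.discr L).natAbs) (LχL : ℂ → ℂ),
      (∀ n : ℕ, Odd n → χL n = (jacobiSym (NumberField.discr L) n : ℂ)) ∧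
      Differentiable ℂ LχL ∧ (∀ s : ℂ, 2 < s.re → LχL s = twistedLSeries g χL s) ∧ LχL 1 ≠ 0

/-- **S2b-NF — `CalibratorDataRealisableNF P`: every member of the calibrator class at an admissible `(L, p)`, `p ≥ 5`,
carries a full datum with non-zero BDP value** (optimal periods exist; Kato 2004 Thm. 12.5 for `g` with (8.1.3)/Prop. 8.12/
Thm. 9.7/Thm. 6.6 (1); BDP/Castella–Hsieh `IsBDPLFunction` for `g`; the Bloch–Kato logarithm of the bottom class exists
(realisation of `P`) and is non-zero in analytic rank one [BSTW24 weak (PR), §6.2.1 p.60 L25–27]; `X′ ≠ 0` likewise by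
(GRL=logheegner) + Gross–Zagier).  PORT-shaped: content exactly when `P` is the intended interface.
[cite: Kato2004Asterisque, Thm. 12.5, p. 229] [cite: BurungaleSkinnerTianWan2024, §6.2.1, p. 60] -/
@[conjecture]
def CalibratorDataRealisableNF (P : NFPort) : Prop :=
  ∀ (p : ℕ) [Fact p.Prime], 5 ≤ p → ∀ (L : Type) [Field L] [NumberField L],
    IsImaginaryQuadratic L → SatisfiesHeegnerHypothesis p L → NumberField.discr L < -4 → Odd (NumberField.discr L) →
    CalibratorSupplyNF L p → ∃ D : NFCalibratorDatum P p L, D.X ≠ 0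

/-- **S2c-NF — `BstwIntegralPerrinRiouNF P`: BSTW's integral Perrin-Riou formula at newform level, in norm form** — on
every calibrator datum the NF crossing identity holds exactly [BSTW24 Thm. 6.4, proof §6.2.1: (comp-with-Kato) p.60 L1–6,
(GRL=logheegner)(i) L8–12, (log-Kato-elt-1) L17–24, `u_L ∈ ℤ_(p)^×` L86–96; `c(ω,γ,γ′) ∈ O^×` Prop. (ERLIint);
`‖𝔤(χ_L)‖_λ = 1`].  PRINT-shaped; every hypothesis used is newform-level (kill criterion of (622) not triggered).
[cite: BurungaleSkinnerTianWan2024, Thm. 6.4 and §6.2.1 (86)–(94), p. 59–60] -/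
@[conjecture]
def BstwIntegralPerrinRiouNF (P : NFPort) : Prop :=
  ∀ (p : ℕ) [Fact p.Prime], 5 ≤ p → ∀ (L : Type) [Field L] [NumberField L],
    IsImaginaryQuadratic L → SatisfiesHeegnerHypothesis p L → NumberField.discr L < -4 → Odd (NumberField.discr L) →
    ∀ D : NFCalibratorDatum P p L, ‖D.X‖ = D.rhs

/-! ## §5 Registrable single-`P` texts (critic V361 P-NF1: ONE `P : NFPort` shared by S1-NF and S2-NF, `∃`-bundled);
the proved glues `aFlatFamR_of_bdvCalibrationNFR` ∕ `aFlatFamR_of_bdvCalibrationPiecesNFR` live in `ErratumRoadFiveBdvCalibrationSplitNF` -/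

/-- **`BdvCalibrationNFR` — the registrable two-piece text**: SOME port `P` carries both S1-NF and the S2-NF family (one `P`,
one `V`).  With the junk port `P₀ = ⊤` the S1-NF conjunct is refutable modulo supply, so the `∃ P` cannot be witnessed by junk
once two calibrator data with different `‖σ‖` exist; with the intended `P` it is S1-NF ∧ S2-NF.  (Pinning `P` to the
constructed Bloch–Kato predicate, when the tree has it, is the stronger registrable form.)
[cite: BertoliniDarmonVenerucci2022, §4 (38) and Lemma 4.6, p. 44–45] [cite: BurungaleSkinnerTianWan2024, Thm. 6.4 and §6.2.1, p. 59–60] -/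
@[conjecture]
def BdvCalibrationNFR : Prop :=
  ∃ P : NFPort, BdvChainExplicitNFR P ∧
    ∀ (p : ℕ) [Fact p.Prime], 5 ≤ p → ∀ (L : Type) [Field L] [NumberField L],
      IsImaginaryQuadratic L → SatisfiesHeegnerHypothesis p L → NumberField.discr L < -4 →
      Odd (NumberField.discr L) → EisensteinPeriodRatioValuationNF P L p

/-- **`BdvCalibrationPiecesNFR` — the registrable four-piece text**: the `P`-free SUPPLY (theorem-shaped in print) and SOME
port `P` carrying S1-NF, REALISABILITY and BSTW's exact identity (one `P` for all three).
[cite: BurungaleSkinnerTianWan2024, Prop. 4.23 p. 45, Lemma 8.2 p. 66, Thm. 6.4 p. 59] [cite: Kato2004Asterisque, Thm. 12.5, p. 229] -/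
@[conjecture]
def BdvCalibrationPiecesNFR : Prop :=
  (∀ (p : ℕ) [Fact p.Prime], 5 ≤ p → ∀ (L : Type) [Field L] [NumberField L],
      IsImaginaryQuadratic L → SatisfiesHeegnerHypothesis p L → NumberField.discr L < -4 →
      Odd (NumberField.discr L) → CalibratorSupplyNF L p) ∧
    ∃ P : NFPort, BdvChainExplicitNFR P ∧ CalibratorDataRealisableNF P ∧ BstwIntegralPerrinRiouNF P

/-- Polarity witness for P-NF1 (proved): over the JUNK port every `S2-NF`-type existence claim reduces to the bare existence
of a datum with `X ≠ 0` and the norm identity — i.e. the port field carries no constraint; this is why items are registered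
`∃ P`-bundled with S1-NF (whose NF conjunct is an identity over ALL data and is refutable for junk `P`). -/
def junkPort : NFPort := ⟨by intros; exact True, by intros; exact True⟩

/-- Over the junk port the field `HasBKLog` holds of every pair `(x, t)` (P-NF1 polarity witness, proved). -/
theorem junkPort_hasBKLog_trivial (p : ℕ) [Fact p.Prime] {N : ℕ} (g : CuspForm (Gamma0 N) 2)
    (ι' : PadicAlgCl p ≃+* ℂ) (ρ : FramedGaloisRep ℚ (PadicAlgCl p) 2) {U : Subgroup (absoluteGaloisGroup ℚ)}
    (x : H1 ρ.toGaloisRep U) (t : PadicAlgCl p) : junkPort.HasBKLog p g ι' ρ x t := by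
  trivial

end Summit.BirchSwinnertonDyer.BirchSwinnertonDyer.Theorems.ErratumRoadFiveBdvCalibrationSplitNF

end
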